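import Mathlib
import Summits.ResolutionOfSingularities.ResolutionOfSingularities.Theorems.RadicialJungCleanModelsCleanProp44FacePresentation
import Summits.ResolutionOfSingularities.ResolutionOfSingularities.Theorems.RadicialJungCleanModelsCleanProp44SuccessorCount
import HarnessLib

/-!
# Route `RadicialJung`, crux `CleanModels` (stmt-ResolutionOfSingularities-15917), line `Sketch` rev 35, stub 6 `stub_cleanProp44` (X44c):
# FROM THE LEAF TOWER TO THE SOLVABLE FACE IN ONE THEOREM — recipe steps (2) + (3) composed over abstract tower + chart data, def-free

Seat decomp-res-hand-2 g21 (structural hand).  END-TO-END COMPOSITION of ✓ `leafSum_tower` (`…LeafTowerStep`), ✓ `map_eq_faceSum` / `natDegree_faceCoeff_le` /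
`faceCoeff_of_isHomogeneous_zero` (`…FacePresentation`) and ✓ `exists_successor_of_solvableFace` (`…SuccessorCount`): the termination author who has
instantiated the tower of memo 4e §2.5 on the tree's blowings up (✓ `exists_chart_leafSum_of_isBlowup` for the first division with its dehomogenised initial
forms, ✓ `exists_chart_leafSum_step_of_isBlowup` for the divisions along `Z_j`; census (S)) and holds the chart map `ε` of the last exceptional divisor gets the
face and the successor line WITHOUT further element bookkeeping.  Data: the tower `(A_j, ψ_j, t_j, v_j, f_j, h_{j,e})_{j ≤ d}` exactly as in ✓ `leafSum_tower`
(level `0` = after the first division, weights `(μ−e)d`, so `δ = d + 1` divisions in all); the base ring `R = 𝒪_{X,c}` with the first stalk map `τ : R → A_0`, the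
first chart's coordinates `uf` and the initial forms `G_e` (homogeneous of degree `(μ−e)(d+1)`) with `h_{0,e} ≡ G_e^τ(uf) (mod v_0)` (✓ `leafSum_base`); the
chart map `ε : A_d → S` of `E` into a `κ[u][T]`-algebra with `ε v_d = 0`, `ε t_d = T`, and its composite `ε₀ : A_0 → S` with the tower (a COCONE: only
`ε h_{d,e} = ε₀ h_{0,e}` and `ε₀ v_0 = 0` are used — `cocone_apply_eq` / `cocone_apply_v_eq_zero` / `cocone_apply_t_eq_zero` derive them, and `ε₀ t_0 = 0`, from a
compatible family `ε_j = ε_{j+1} ∘ ψ_j`), acting on `R` as constants `σ : R → κ` and on `uf` as polynomials `y_i` of degree `≤ 1` (point blow-up, `u₁`-chart,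
`d ≥ 1`: `y = (0, 1, u)`):

* `map_eval₂_eq_of_factor` — `ε₀ (G^τ(uf)) = Λ(Ḡ^σ(y))` for any `Λ : κ[u] → S` through which `ε₀ τ` and `ε₀ uf` factor.
* `cocone_apply_eq` / `cocone_apply_v_eq_zero` / `cocone_apply_t_eq_zero` / `cocone_apply_h` — bookkeeping of a compatible family of chart maps.
* `tower_face` — **THE FACE**: `ε(f_d) = Φ` with `Φ = Σ_{e≤μ} T^e·C_e`, `C_e = Ḡ_e^σ(y)`, `deg_T Φ ≤ μ`, `Φ_μ = σ(G_μ(0))` a constant, `deg_u Φ_0 ≤ μ(d+1)`.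
* `tower_successor` — **THE SUCCESSOR**: if moreover `σ(G_μ(0)) ≠ 0` (Case II: the `t^μ`-coefficient of `f` is a unit), `p ∣ d + 1` and a non-unit `π ∈ κ[u][T]`
  has `π^μ ∣ Φ` (a curve of `E` along which the transform keeps order `μ`; ✓ `pow_dvd_of_pow_dvd_algebraMap` descends it from one point), then
  `π = a(T + λ)`, `Φ = c(T + λ)^μ`, `deg λ ≤ d + 1`, `deg λ′ ≤ d − 1` — the input of ✓ `births_on_successor_le` / ✓ `descent_le_sub_two`.

Honest framing: OURS, composition only; the instantiation (census (S)) and the corner (B5′) are NOT addressed; nothing here proves X44c, any case of `CleanModels`, or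
resolution of singularities in characteristic `p`. [cite: CossartPiltant2008, Lemma 4.3 (5); Prop. 4.4 (proof, p. 11)] [cite: CossartJannsenSaito2020, Lemma 7.5]
-/

noncomputable section

set_option linter.dupNamespace false -- mandated namespace of this single-conjunct summit

open Polynomial

namespace Summit.ResolutionOfSingularities.ResolutionOfSingularities.Theorems.RadicialJung.CleanModels

section TowerFace

variable {k : Type*} [Field k]
variable (Aj : ℕ → Type*) [∀ j, CommRing (Aj j)] (ψ : ∀ j, Aj j →+* Aj (j + 1)) (μ d : ℕ)
  (t v f : ∀ j, Aj j) (h : ∀ j, ℕ → Aj j)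
variable {R : Type*} [CommRing R] {σι : Type*} (τ : R →+* Aj 0) (uf : σι → Aj 0) (G : ℕ → MvPolynomial σι R)
variable {S : Type*} [CommRing S] (ε₀ : Aj 0 →+* S) (ε : Aj d →+* S) (σ : R →+* k) (y : σι → k[X])

/-- **A pulled-back initial form on the exceptional chart**: if `ε₀ τ = Λ ∘ C ∘ σ` on `R` and `ε₀ (uf_i) = Λ(y_i)`, then `ε₀ (G^τ(uf)) = Λ(Ḡ^σ(y))` with
`Ḡ^σ(y) = eval₂ (C ∘ σ) y G`. [folklore] -/
theorem map_eval₂_eq_of_factor (Λ : k[X] →+* S) (hσ : ∀ r, ε₀ (τ r) = Λ (C (σ r))) (hy : ∀ i, ε₀ (uf i) = Λ (y i))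
    (G₁ : MvPolynomial σι R) :
    ε₀ (MvPolynomial.eval₂ τ uf G₁) = Λ (MvPolynomial.eval₂ ((C : k →+* k[X]).comp σ) y G₁) := by
  rw [MvPolynomial.eval₂_comp_left ε₀, MvPolynomial.eval₂_comp_left Λ]
  congr 1
  · ext r; simp [hσ]
  · ext i : 1; simp [Function.comp, hy]

/-! ### The cocone of chart maps along the tower -/

/-- Along a compatible family `ε_j = ε_{j+1} ∘ ψ_j` of maps out of the tower, a compatible family of elements `ψ_j(x_j) = x_{j+1}` (the exceptional parameter
`v`, the coefficients `h_{·,e}`) has the same image at every level: `ε_m(x_m) = ε_0(x_0)`. [folklore] -/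
theorem cocone_apply_eq (εj : ∀ j, Aj j →+* S) (hε : ∀ j x, εj j x = εj (j + 1) (ψ j x)) (x : ∀ j, Aj j)
    (hx : ∀ j, ψ j (x j) = x (j + 1)) : ∀ m, εj m (x m) = εj 0 (x 0) := by
  intro m
  induction m with
  | zero => rfl
  | succ m ih => rw [← hx m, ← hε, ih]

/-- Hence `ε_d(v_d) = 0` gives `ε_j(v_j) = 0` at EVERY level (in particular `ε₀ v_0 = 0`, hypothesis `hθv` of `tower_face`). [folklore] -/
theorem cocone_apply_v_eq_zero (εj : ∀ j, Aj j →+* S) (hε : ∀ j x, εj j x = εj (j + 1) (ψ j x))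
    (hv : ∀ j, ψ j (v j) = v (j + 1)) (hvd : εj d (v d) = 0) (j : ℕ) : εj j (v j) = 0 := by
  rw [cocone_apply_eq Aj ψ εj hε v hv j, ← cocone_apply_eq Aj ψ εj hε v hv d, hvd]

/-- And `ε_j(t_j) = 0` at every level: the strict transform of the leaf read one level up is divisible by the exceptional parameter (`ψ_j t_j = v_{j+1} t_{j+1}`)
— for the point blow-up in the `u₁`-chart this is the coordinate `y_{i₀} = 0` of `tower_face`. [folklore] -/
theorem cocone_apply_t_eq_zero (εj : ∀ j, Aj j →+* S) (hε : ∀ j x, εj j x = εj (j + 1) (ψ j x))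
    (hv : ∀ j, ψ j (v j) = v (j + 1)) (ht : ∀ j, ψ j (t j) = v (j + 1) * t (j + 1)) (hvd : εj d (v d) = 0)
    (j : ℕ) : εj j (t j) = 0 := by
  rw [hε j, ht j, map_mul, cocone_apply_v_eq_zero Aj ψ d v εj hε hv hvd (j + 1), zero_mul]

/-- The coefficients along the cocone: `ε_d(h_{d,e}) = ε_0(h_{0,e})` (hypothesis `hθh` of `tower_face`). [folklore] -/
theorem cocone_apply_h (εj : ∀ j, Aj j →+* S) (hε : ∀ j x, εj j x = εj (j + 1) (ψ j x))
    (hh : ∀ j e, h (j + 1) e = ψ j (h j e)) (e : ℕ) : εj d (h d e) = εj 0 (h 0 e) :=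
  cocone_apply_eq Aj ψ εj hε (fun j => h j e) (fun j => (hh j e).symm) d

variable [Fintype σι] [Algebra (k[X])[X] S]

/-- **FROM THE TOWER TO THE FACE** (recipe step (2), end to end).  See the module docstring for the data.  Conclusion: `ε(f_d) = Φ` (as an element of the
`κ[u][T]`-algebra `S`) for the face polynomial `Φ = Σ_{e≤μ} T^e · Ḡ_e^σ(y)`, with `deg_T Φ ≤ μ`, `Φ_μ = C(σ(G_μ(0)))` and `deg_u Φ_0 ≤ μ(d+1)`.
[cite: CossartPiltant2008, Prop. 4.4 (proof, p. 11)] [cite: CossartJannsenSaito2020, Lemma 7.5] -/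
theorem tower_face (hv : ∀ j, ψ j (v j) = v (j + 1)) (hvnzd : ∀ j, v (j + 1) ∈ nonZeroDivisors (Aj (j + 1)))
    (ht : ∀ j, ψ j (t j) = v (j + 1) * t (j + 1)) (hf : ∀ j, v (j + 1) ^ μ * f (j + 1) = ψ j (f j))
    (hh : ∀ j e, h (j + 1) e = ψ j (h j e))
    (h0 : f 0 = ∑ e ∈ Finset.range (μ + 1), t 0 ^ e * v 0 ^ ((μ - e) * d) * h 0 e)
    (hG : ∀ e, (G e).IsHomogeneous ((μ - e) * (d + 1)))
    (hh0 : ∀ e ≤ μ, h 0 e - MvPolynomial.eval₂ τ uf (G e) ∈ Ideal.span {v 0})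
    (hθh : ∀ e ≤ μ, ε (h d e) = ε₀ (h 0 e)) (hθv : ε₀ (v 0) = 0)
    (hεv : ε (v d) = 0) (hεt : ε (t d) = algebraMap (k[X])[X] S X)
    (hσ : ∀ r, ε₀ (τ r) = algebraMap (k[X])[X] S (C (C (σ r))))
    (hy : ∀ i, ε₀ (uf i) = algebraMap (k[X])[X] S (C (y i))) (hy1 : ∀ i, (y i).natDegree ≤ 1) :
    ε (f d) = algebraMap (k[X])[X] S
        (∑ e ∈ Finset.range (μ + 1), (X : (k[X])[X]) ^ e * C (MvPolynomial.eval₂ ((C : k →+* k[X]).comp σ) y (G e))) ∧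
      (∑ e ∈ Finset.range (μ + 1), (X : (k[X])[X]) ^ e * C (MvPolynomial.eval₂ ((C : k →+* k[X]).comp σ) y (G e))).natDegree ≤ μ ∧
      (∑ e ∈ Finset.range (μ + 1), (X : (k[X])[X]) ^ e * C (MvPolynomial.eval₂ ((C : k →+* k[X]).comp σ) y (G e))).coeff μ =
        C (σ (MvPolynomial.coeff 0 (G μ))) ∧
      ((∑ e ∈ Finset.range (μ + 1), (X : (k[X])[X]) ^ e * C (MvPolynomial.eval₂ ((C : k →+* k[X]).comp σ) y (G e))).coeff 0).natDegree ≤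
        μ * (d + 1) := by
  -- the bottom of the tower: `f_d ≡ Σ t_d^e h_{d,e} (mod v_d)`
  have hbottom := leafSum_tower_bottom Aj ψ μ d t v f h hv hvnzd ht hf hh h0 (h d) (fun e _ => by rw [sub_self]; exact zero_mem _)
  -- the coefficients: `ε h_{d,e} = C(Ḡ_e^σ(y))`
  have hcoef : ∀ e ≤ μ, ε (h d e) = algebraMap (k[X])[X] S (C (MvPolynomial.eval₂ ((C : k →+* k[X]).comp σ) y (G e))) := by
    intro e he
    have h1 : ε (h d e) = ε₀ (MvPolynomial.eval₂ τ uf (G e)) := by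
      rw [hθh e he]
      obtain ⟨s, hs⟩ := Ideal.mem_span_singleton'.mp (hh0 e he)
      have h2 : ε₀ (h 0 e - MvPolynomial.eval₂ τ uf (G e)) = 0 := by rw [← hs, map_mul, hθv, mul_zero]
      rwa [map_sub, sub_eq_zero] at h2
    rw [h1, map_eval₂_eq_of_factor Aj τ uf ε₀ σ y ((algebraMap (k[X])[X] S).comp C) (fun r => by simp [hσ]) (fun i => by simp [hy])]
    rfl
  refine ⟨map_eq_faceSum ε μ (h d) hbottom hεv hεt _ hcoef, natDegree_faceSum_le μ _, ?_, ?_⟩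
  · rw [coeff_faceSum μ _ le_rfl, faceCoeff_of_isHomogeneous_zero σ y (by simpa using hG μ)]
  · rw [coeff_faceSum μ _ (Nat.zero_le _)]
    exact natDegree_faceCoeff_le _ (natDegree_C_comp_apply σ) y hy1 (by simpa using hG 0)

/-- **FROM THE TOWER TO THE SUCCESSOR LINE** (recipe steps (2) + (3)).  Under the data of `tower_face`, if the `t^μ`-coefficient of `f` is a unit at `c`
(`σ(G_μ(0)) ≠ 0`), `1 ≤ μ`, `p ∣ d + 1` (as `((d + 1 : ℕ) : κ) = 0`) and a non-unit `π ∈ κ[u][T]` satisfies `π^μ ∣ Φ`, then `π = a·(T + λ)`, `Φ = c·(T + λ)^μ`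
with `c = σ(G_μ(0))`, `deg λ ≤ d + 1`, `deg λ′ ≤ d − 1`, and `ε(f_d) = Φ`. [cite: CossartPiltant2008, Lemma 4.3 (5); Prop. 4.4 (proof, p. 11)] -/
theorem tower_successor (hv : ∀ j, ψ j (v j) = v (j + 1)) (hvnzd : ∀ j, v (j + 1) ∈ nonZeroDivisors (Aj (j + 1)))
    (ht : ∀ j, ψ j (t j) = v (j + 1) * t (j + 1)) (hf : ∀ j, v (j + 1) ^ μ * f (j + 1) = ψ j (f j))
    (hh : ∀ j e, h (j + 1) e = ψ j (h j e))
    (h0 : f 0 = ∑ e ∈ Finset.range (μ + 1), t 0 ^ e * v 0 ^ ((μ - e) * d) * h 0 e)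
    (hG : ∀ e, (G e).IsHomogeneous ((μ - e) * (d + 1)))
    (hh0 : ∀ e ≤ μ, h 0 e - MvPolynomial.eval₂ τ uf (G e) ∈ Ideal.span {v 0})
    (hθh : ∀ e ≤ μ, ε (h d e) = ε₀ (h 0 e)) (hθv : ε₀ (v 0) = 0)
    (hεv : ε (v d) = 0) (hεt : ε (t d) = algebraMap (k[X])[X] S X)
    (hσ : ∀ r, ε₀ (τ r) = algebraMap (k[X])[X] S (C (C (σ r))))
    (hy : ∀ i, ε₀ (uf i) = algebraMap (k[X])[X] S (C (y i))) (hy1 : ∀ i, (y i).natDegree ≤ 1)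
    (hμ : 1 ≤ μ) (hc : σ (MvPolynomial.coeff 0 (G μ)) ≠ 0) (hd : ((d + 1 : ℕ) : k) = 0)
    {π : (k[X])[X]} (hπ : ¬ IsUnit π)
    (hdvd : π ^ μ ∣ ∑ e ∈ Finset.range (μ + 1), (X : (k[X])[X]) ^ e * C (MvPolynomial.eval₂ ((C : k →+* k[X]).comp σ) y (G e))) :
    ∃ (a : k) (lam : k[X]), a ≠ 0 ∧ π = C (C a) * (X + C lam) ∧
      (∑ e ∈ Finset.range (μ + 1), (X : (k[X])[X]) ^ e * C (MvPolynomial.eval₂ ((C : k →+* k[X]).comp σ) y (G e))) =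
        C (C (σ (MvPolynomial.coeff 0 (G μ)))) * (X + C lam) ^ μ ∧
      lam.natDegree ≤ d + 1 ∧ (derivative lam).natDegree ≤ d + 1 - 2 ∧
      ε (f d) = algebraMap (k[X])[X] S (C (C (σ (MvPolynomial.coeff 0 (G μ)))) * (X + C lam) ^ μ) := by
  obtain ⟨hface, hdeg, htop, hC0⟩ := tower_face Aj ψ μ d t v f h τ uf G ε₀ ε σ y hv hvnzd ht hf hh h0 hG hh0 hθh hθv hεv hεt hσ hy hy1
  obtain ⟨a, lam, ha, hπeq, hΦ, hlam, hlam'⟩ := exists_successor_of_solvableFace hμ hdeg hc htop hπ hdvd hC0 hd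
  exact ⟨a, lam, ha, hπeq, hΦ, hlam, hlam', by rw [hface, hΦ]⟩

end TowerFace

/-! ## Appended (hand-2 g21): the cocone lemmas for a FINITE tower (relations only below level `d`)

The lemmas `cocone_apply_*` above quantify the compatibility `ε_j = ε_{j+1} ∘ ψ_j` over ALL `j : ℕ`; a tower that is extended beyond its last level `d` (e.g. by zero
rings, which satisfies the relations of `leafSum_tower` / `tower_face`) admits such an everywhere-compatible cocone into `S` only when `S` is trivial.  The usable
versions restrict every hypothesis to the levels `j < d` actually traversed; `tower_face` consumes exactly their conclusions (`hθh`, `hθv`) and `y_{i₀} = 0`. -/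

section FiniteCocone

variable (Aj : ℕ → Type*) [∀ j, CommRing (Aj j)] (ψ : ∀ j, Aj j →+* Aj (j + 1)) (d : ℕ)
  (t v : ∀ j, Aj j) (h : ∀ j, ℕ → Aj j) {S : Type*} [CommRing S] (εj : ∀ j, Aj j →+* S)

/-- Along a family of maps compatible BELOW LEVEL `d` (`ε_j = ε_{j+1} ∘ ψ_j` for `j < d`), a family of elements compatible below `d` has the same image at every
level `m ≤ d`. [folklore] -/
theorem cocone_apply_eq_of_lt (hε : ∀ j < d, ∀ x, εj j x = εj (j + 1) (ψ j x)) (x : ∀ j, Aj j)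
    (hx : ∀ j < d, ψ j (x j) = x (j + 1)) : ∀ m ≤ d, εj m (x m) = εj 0 (x 0) := by
  intro m
  induction m with
  | zero => intro _; rfl
  | succ m ih =>
    intro hm
    rw [← hx m (by omega), ← hε m (by omega), ih (by omega)]

/-- `ε_d(v_d) = 0` ⟹ `ε_j(v_j) = 0` for every `j ≤ d` (hypothesis `hθv : ε₀ v_0 = 0` of `tower_face`). [folklore] -/
theorem cocone_apply_v_eq_zero_of_lt (hε : ∀ j < d, ∀ x, εj j x = εj (j + 1) (ψ j x))
    (hv : ∀ j < d, ψ j (v j) = v (j + 1)) (hvd : εj d (v d) = 0) {j : ℕ} (hj : j ≤ d) : εj j (v j) = 0 := by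
  rw [cocone_apply_eq_of_lt Aj ψ d εj hε v hv j hj, ← cocone_apply_eq_of_lt Aj ψ d εj hε v hv d le_rfl, hvd]

/-- `ε_j(t_j) = 0` for every `j < d` (the strict transform of the leaf read one level up is divisible by the exceptional parameter); for the point blow-up read after
`d ≥ 1` further divisions this is the coordinate `y_{i₀} = ε₀(t_0) = 0` of `tower_face`. [folklore] -/
theorem cocone_apply_t_eq_zero_of_lt (hε : ∀ j < d, ∀ x, εj j x = εj (j + 1) (ψ j x))
    (hv : ∀ j < d, ψ j (v j) = v (j + 1)) (ht : ∀ j < d, ψ j (t j) = v (j + 1) * t (j + 1)) (hvd : εj d (v d) = 0)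
    {j : ℕ} (hj : j < d) : εj j (t j) = 0 := by
  rw [hε j hj, ht j hj, map_mul, cocone_apply_v_eq_zero_of_lt Aj ψ d v εj hε hv hvd (by omega : j + 1 ≤ d), zero_mul]

/-- The coefficients: `ε_d(h_{d,e}) = ε_0(h_{0,e})` (hypothesis `hθh` of `tower_face`). [folklore] -/
theorem cocone_apply_h_of_lt (hε : ∀ j < d, ∀ x, εj j x = εj (j + 1) (ψ j x))
    (hh : ∀ j < d, ∀ e, h (j + 1) e = ψ j (h j e)) (e : ℕ) : εj d (h d e) = εj 0 (h 0 e) :=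
  cocone_apply_eq_of_lt Aj ψ d εj hε (fun j => h j e) (fun j hj => (hh j hj e).symm) d le_rfl

end FiniteCocone

end Summit.ResolutionOfSingularities.ResolutionOfSingularities.Theorems.RadicialJung.CleanModels

end
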